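import Summits.QuantumFields.YangMills.Theorems.BalabanUVNodesK0RecordFormatNamesFluctE
import Summits.QuantumFields.YangMills.Theorems.BalabanUVNodesPortS1SmallLetter
import Summits.QuantumFields.YangMills.Theorems.BalabanUVNodesPortS1HalvesDefs

/-!
# NODE O port — `stub_P0C` supply chain, brick B1 (owner memo `Lines/pta_residueW-P0C-SUPPLY-OWNER-v1.md` §3): THE (2.11) MATRIX `recordPreckLoc = C_locᵀ·Sk_blk·C_loc` IS SYMMETRIC
# (the `IsHermitian` half of row (P5)'s `Matrix.PosDef`), CONDITIONAL ON THE P0-ℝ ROW «`x ↦ A(U_k(V′_xV^{(k)}))` is `C²` at `0`» and the explicit-map row «`G(V′_xV^{(k)})` is `C²` at `0`»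

Cell `ym-nodeO-ideate`, porter seat PT-A-1 (gen 10); `--kind proof --supports stmt-QuantumFields-27930 --as helper`; count-neutral.  [I] = [Balaban1987RG1]; [15] = [Balaban1985Variational].
Director-ym R702-ym docket (3) (OWN `stub_P0C ⇐ P0FamilySupply`), class (II) row (M5′) of the owner memo: the hidden symmetry row inside (P5) (hand-P0C memo v1.3 R4: «`PosDef` includes `IsHermitian`; symmetry of
`Sk_blk` needs symmetry of `D²(recordAUk)(0)` (Schwarz ⟸ C² at 0 ⟸ selector smoothness), of `recordC2` and `recordG₂` (explicit smooth maps)»).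

WHAT IS PROVED.  ★ `recordΔk₁_symm_of_contDiffAt` — the corrected (2.11) polar form `recordΔk₁ = D²f(0) − 2·Df(0)∘h∘C₂ + D²G(0)` (✓`…FluctC` :80) is SYMMETRIC whenever `f := recordAUk … Vk` (the action
through the level-`k` selector along the chart), `Q̃(Vk, ·)` and `G := recordGf Vk` are `C²` at `0` (Mathlib `ContDiffAt.isSymmSndFDerivAt`; the middle term is `(u,v) ↦ Df(0)(h(C₂(u,v)))` with
`C₂ = ½·D²Q̃(0)` symmetric); `recordSk₁_isSymm_of_contDiffAt`, `recordSkBlk_isSymm_of_contDiffAt` (the matrices); ★★ `isHermitian_recordPreckLoc_of_contDiffAt` (`C_locᵀ S C_loc`); and, with `Q̃`'s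
smoothness DISCHARGED at every (0.4)-guarded background by ✓`contDiffAt_recordQt_of_small`, ★★ `isHermitian_recordPreckLoc_of_small` — CONDITIONAL only on the two displayed `C²` rows (the first is
⟨stmt-QuantumFields-26900⟩ `P0Content`'s real-analytic selector germ at index `(k−1, n+1)`; the second is the gauge-fixing function of record along the chart, an explicit path-product map).

HONEST FRAMING.  Linear-algebra∕calculus bookkeeping; a CONDITIONAL brick (two `ContDiffAt` hypotheses displayed, NOT discharged — the first IS P0-ℝ content); nothing of Bałaban's estimates asserted,
ported or discharged; (P5)'s positivity half, (P2), (P4-d), (P4-lat), (P5ᶜ) untouched; `stub_P0C` NOT closed; ⟨27930⟩ OPEN 1∕3; ⟨26900⟩ 0∕4; NODE O 0∕1; COUNT 8∕28 · K 1∕4 UNMOVED; finite `𝕋⁴_{L^K}`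
at fixed ε — NOT continuum ∕ OS; **the Yang–Mills mass gap (Clay) is NOT proved by any of this.**  No `sorry`, no `def`, no `instance`; standard axioms only.
-/

noncomputable section

open scoped BigOperators Matrix.Norms.L2Operator Topology

namespace Summit.QuantumFields.YangMills.Theorems.BalabanUVNodesPortS1

open Summit.QuantumFields.YangMills.Theorems.K0RecordFormatNames
open Literature.MathematicalPhysics.QuantumFieldTheory.Balaban1983to89
open Literature.MathematicalPhysics.QuantumFieldTheory.Balaban1983to89.Node00
open Literature.MathematicalPhysics.QuantumFieldTheory.Balaban1983to89.T4Continuum (T4Family)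
open Literature.MathematicalPhysics.QuantumFieldTheory.Balaban1983to89.BlockAveraging (Small)
open Literature.MathematicalPhysics.QuantumFieldTheory.Balaban1983to89.ExpMeanLog (expMeanLogSU)
open _root_.Matrix

variable (F : T4Family)

/-! ## §1  The (2.11) polar form is symmetric under the two `C²` rows -/

/-- `bilinOf B u v = B u v`. [cite: Balaban1987RG1, (1.5) p.261 (bookkeeping)] -/
theorem bilinOf_apply {E G : Type*} [NormedAddCommGroup E] [NormedSpace ℝ E] [NormedAddCommGroup G] [NormedSpace ℝ G] (B : E →L[ℝ] E →L[ℝ] G) (u v : E) :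
    bilinOf B u v = B u v := rfl

/-- Unfolding of the corrected (2.11) polar form on two vectors: `Δ^{(k)}(u,v) = D²f(0)(u,v) − 2·Df(0)(h(C₂(u,v))) + D²G(0)(u,v)`. [cite: Balaban1987RG1, (2.10)–(2.11) p.267] -/
theorem recordΔk₁_apply (k K : ℕ) (εbg : ℝ) (Vk : GaugeField (F.P K) k (SU 2)) (hopLin : (PBond (F.P K) (k + 1) → MatA 2) →ₗ[ℝ] (FluctIdx F k K → ℝ))
    (u v : FluctIdx F k K → ℝ) :
    recordΔk₁ F k K εbg Vk hopLin u v =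
      recordD2AUk F k K εbg Vk u v - (2 : ℝ) * recordDAUk F k K εbg Vk (hopLin (recordC2 F k K Vk u v)) + recordG₂ F k K Vk u v := by
  simp only [recordΔk₁, LinearMap.add_apply, LinearMap.sub_apply, LinearMap.smul_apply, LinearMap.compr₂_apply, LinearMap.coe_comp, Function.comp_apply,
    ContinuousLinearMap.coe_coe, bilinOf_apply, smul_eq_mul]

/-- ★ **THE (2.11) POLAR FORM IS SYMMETRIC** when `f = recordAUk … Vk`, `Q̃(Vk, ·) = recordQt Vk` and `G = recordGf Vk` are `C²` at `0` (Schwarz for the three second derivatives; `C₂ = ½·D²Q̃(0)`).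
[cite: Balaban1987RG1, (2.10)–(2.11) p.267, (1.5) p.261] -/
theorem recordΔk₁_symm_of_contDiffAt (k K : ℕ) (εbg : ℝ) (Vk : GaugeField (F.P K) k (SU 2)) (hopLin : (PBond (F.P K) (k + 1) → MatA 2) →ₗ[ℝ] (FluctIdx F k K → ℝ))
    (hA : ContDiffAt ℝ 2 (recordAUk F k K εbg Vk) 0) (hQ : ContDiffAt ℝ 2 (recordQt F k K Vk) 0) (hG : ContDiffAt ℝ 2 (recordGf F k K Vk) 0)
    (u v : FluctIdx F k K → ℝ) :
    recordΔk₁ F k K εbg Vk hopLin u v = recordΔk₁ F k K εbg Vk hopLin v u := by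
  have h2 : minSmoothness ℝ 2 ≤ (2 : WithTop ℕ∞) := by simp
  have hAs := (hA.isSymmSndFDerivAt h2).eq u v
  have hQs := (hQ.isSymmSndFDerivAt h2).eq u v
  have hGs := (hG.isSymmSndFDerivAt h2).eq u v
  have hC2 : recordC2 F k K Vk u v = recordC2 F k K Vk v u := by
    show ((2 : ℝ)⁻¹ • fderiv ℝ (fun x => fderiv ℝ (recordQt F k K Vk) x) 0) u v = ((2 : ℝ)⁻¹ • fderiv ℝ (fun x => fderiv ℝ (recordQt F k K Vk) x) 0) v u
    simp only [FunLike.coe_smul, Pi.smul_apply]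
    rw [show (fun x => fderiv ℝ (recordQt F k K Vk) x) = fderiv ℝ (recordQt F k K Vk) from rfl, hQs]
  rw [recordΔk₁_apply, recordΔk₁_apply, hC2]
  show fderiv ℝ (fun x => fderiv ℝ (recordAUk F k K εbg Vk) x) 0 u v - _ + fderiv ℝ (fun x => fderiv ℝ (recordGf F k K Vk) x) 0 u v =
    fderiv ℝ (fun x => fderiv ℝ (recordAUk F k K εbg Vk) x) 0 v u - _ + fderiv ℝ (fun x => fderiv ℝ (recordGf F k K Vk) x) 0 v u
  rw [show (fun x => fderiv ℝ (recordAUk F k K εbg Vk) x) = fderiv ℝ (recordAUk F k K εbg Vk) from rfl,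
    show (fun x => fderiv ℝ (recordGf F k K Vk) x) = fderiv ℝ (recordGf F k K Vk) from rfl, hAs, hGs]

/-! ## §2  The matrices: `Sk`, `Sk_blk`, `C_locᵀ·Sk_blk·C_loc` -/

/-- The corrected (2.11) matrix `recordSk₁` is symmetric under the two `C²` rows. [cite: Balaban1987RG1, (2.11) p.267] -/
theorem recordSk₁_isSymm_of_contDiffAt (k K : ℕ) (εbg : ℝ) (Vk : GaugeField (F.P K) k (SU 2)) (hopLin : (PBond (F.P K) (k + 1) → MatA 2) →ₗ[ℝ] (FluctIdx F k K → ℝ))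
    (hA : ContDiffAt ℝ 2 (recordAUk F k K εbg Vk) 0) (hQ : ContDiffAt ℝ 2 (recordQt F k K Vk) 0) (hG : ContDiffAt ℝ 2 (recordGf F k K Vk) 0) :
    (recordSk₁ F k K εbg Vk hopLin).IsSymm := by
  classical
  refine Matrix.IsSymm.ext fun i j => ?_
  show LinearMap.toMatrix₂' ℝ (recordΔk₁ F k K εbg Vk hopLin) j i = LinearMap.toMatrix₂' ℝ (recordΔk₁ F k K εbg Vk hopLin) i j
  rw [LinearMap.toMatrix₂'_apply, LinearMap.toMatrix₂'_apply]
  exact recordΔk₁_symm_of_contDiffAt F k K εbg Vk hopLin hA hQ hG _ _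

/-- `Sk_blk` (block re-indexing of `Sk`) is symmetric under the two `C²` rows. [cite: Balaban1987RG1, (2.11) p.267] -/
theorem recordSkBlk_isSymm_of_contDiffAt (k K : ℕ) (εbg : ℝ) (Vk : GaugeField (F.P K) k (SU 2)) (hopLin : (PBond (F.P K) (k + 1) → MatA 2) →ₗ[ℝ] (FluctIdx F k K → ℝ))
    (hA : ContDiffAt ℝ 2 (recordAUk F k K εbg Vk) 0) (hQ : ContDiffAt ℝ 2 (recordQt F k K Vk) 0) (hG : ContDiffAt ℝ 2 (recordGf F k K Vk) 0) :
    (recordSkBlk F k K εbg Vk hopLin).IsSymm :=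
  (recordSk₁_isSymm_of_contDiffAt F k K εbg Vk hopLin hA hQ hG).submatrix _

/-- ★★ **`recordPreckLoc = C_locᵀ·Sk_blk·C_loc` IS SYMMETRIC (`IsHermitian` over `ℝ`)** under the two `C²` rows — the `IsHermitian` conjunct of row (P5)'s `Matrix.PosDef`.
[cite: Balaban1987RG1, (2.11) p.267, p.268 («C*Δ^{(k)}C»)] -/
theorem isHermitian_recordPreckLoc_of_contDiffAt (k K : ℕ) (εbg : ℝ) (Vk : GaugeField (F.P K) k (SU 2)) (hopLin : (PBond (F.P K) (k + 1) → MatA 2) →ₗ[ℝ] (FluctIdx F k K → ℝ))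
    (hA : ContDiffAt ℝ 2 (recordAUk F k K εbg Vk) 0) (hQ : ContDiffAt ℝ 2 (recordQt F k K Vk) 0) (hG : ContDiffAt ℝ 2 (recordGf F k K Vk) 0) :
    (recordPreckLoc F k K εbg Vk hopLin).IsHermitian := by
  classical
  have hS := recordSkBlk_isSymm_of_contDiffAt F k K εbg Vk hopLin hA hQ hG
  show ((recordCopLoc F k K Vk)ᵀ * recordSkBlk F k K εbg Vk hopLin * recordCopLoc F k K Vk).IsHermitian
  have hSh : (recordSkBlk F k K εbg Vk hopLin).IsHermitian := by
    show (recordSkBlk F k K εbg Vk hopLin)ᴴ = recordSkBlk F k K εbg Vk hopLin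
    rw [conjTranspose_eq_transpose_of_trivial]; exact hS
  have h := Matrix.isHermitian_conjTranspose_mul_mul (recordCopLoc F k K Vk) hSh
  rwa [conjTranspose_eq_transpose_of_trivial] at h

/-! ## §3  At a (0.4)-guarded background the `Q̃`-row is discharged -/

/-- ★★ **SYMMETRY OF `recordPreckLoc` AT EVERY GUARDED BACKGROUND, CONDITIONAL ON THE P0-ℝ ROW AND THE GAUGE-FIXING ROW ONLY**: if every coarse bond of `Vk` is (0.4)-guarded then `Q̃(Vk, ·)` is
`C^∞` at `0` (✓`contDiffAt_recordQt_of_small`), so `recordPreckLoc … Vk (hopLinGraph Vk)` is symmetric as soon as `x ↦ A(U_k(V′_xVk))` and `x ↦ G(V′_xVk)` are `C²` at `0`.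
[cite: Balaban1987RG1, (2.11) p.267, p.268; Balaban1985Variational, Thm 1 p.279] -/
theorem isHermitian_recordPreckLoc_of_small (k K : ℕ) (hk : k + 1 ≤ (F.P K).m + (F.P K).K) (εbg : ℝ) (Vk : GaugeField (F.P K) k (SU 2))
    (hsmall : ∀ c : PBond (F.P K) (k + 1), Small expMeanLogSU Vk c)
    (hA : ContDiffAt ℝ 2 (recordAUk F k K εbg Vk) 0) (hG : ContDiffAt ℝ 2 (recordGf F k K Vk) 0) :
    (recordPreckLoc F k K εbg Vk (hopLinGraph F k K Vk)).IsHermitian :=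
  isHermitian_recordPreckLoc_of_contDiffAt F k K εbg Vk (hopLinGraph F k K Vk) hA
    ((contDiffAt_recordQt_of_small F k K hk Vk hsmall).of_le le_top) hG

end Summit.QuantumFields.YangMills.Theorems.BalabanUVNodesPortS1

end
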